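import Summits.Ventures.HodgeRepro2.T5L2Partition

/-!
# The summand `V hs` of the partition decomposition is `L²(s, μ|_s)`

Companion of `T5L2Partition.lean` (cell pub-hodge-repro2, seat p5, Tier 5; kernel witness for
route/T5-N4-p5.md v12 (A3) STEP 1's «L^{K_f} = ⊕_{i=1}^{h} L²(Γ_i\G_∞) as unitary G_∞-modules»).
`T5L2Partition` shows `L²(μ) = ⊕̂_i V (Y i)` for a finite measurable partition `(Y i)`; this file
identifies each summand: restriction of the measure is a linear isometry
`restrictEquiv hs : V hs ≃ₗᵢ[𝕜] L²(μ|_s)` with inverse «extension by zero», and it is equivariant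
for every measure-preserving `φ` with `φ⁻¹(s) = s` (`toRestrict_compMeasurePreserving`) — so the
decomposition reads `L²(X) = ⊕_i L²(Y_i)` as modules over the measure-preserving maps fixing the
pieces.  Mathlib only; nothing about groups, orbits or Haar measure is asserted.
-/

open MeasureTheory Set
open scoped ENNReal InnerProductSpace

namespace Summit.Ventures.HodgeRepro2.T5L2Partition

variable {X : Type*} [MeasurableSpace X] {μ : Measure X}
variable {𝕜 : Type*} [RCLike 𝕜] {E : Type*} [NormedAddCommGroup E] [InnerProductSpace 𝕜 E]
variable {s : Set X}

/-! ### The summand `V hs` IS `L²(s, μ|_s)`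

The `i`-th summand of the decomposition is identified with `L²(Y_i)`: restriction of the measure
gives a linear isometry `V hs ≃ₗᵢ[𝕜] L²(μ|_s)` (`restrictEquiv`), with inverse «extension by
zero», and it is equivariant for a measure-preserving `φ` with `φ⁻¹(s) = s`
(`toRestrict_compMeasurePreserving`). -/

section Summand

/-- Restriction of the measure: `L²(μ) → L²(μ|_s)`, `f ↦ f`. -/
noncomputable def toRestrict (s : Set X) (f : Lp E 2 μ) : Lp E 2 (μ.restrict s) :=
  ((Lp.memLp f).restrict s).toLp f

/-- Extension by zero: `L²(μ|_s) → L²(μ)`, `g ↦ 1_s g`. -/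
noncomputable def ofRestrict (hs : MeasurableSet s) (g : Lp E 2 (μ.restrict s)) : Lp E 2 μ :=
  ((memLp_indicator_iff_restrict hs).mpr (Lp.memLp g)).toLp (s.indicator g)

/-- `toRestrict s f` is represented by `f` itself, `μ|_s`-a.e. -/
theorem coeFn_toRestrict (s : Set X) (f : Lp E 2 μ) : ⇑(toRestrict s f) =ᵐ[μ.restrict s] f :=
  MemLp.coeFn_toLp _

/-- `ofRestrict hs g` is represented by `s.indicator g`, `μ`-a.e. -/
theorem coeFn_ofRestrict (hs : MeasurableSet s) (g : Lp E 2 (μ.restrict s)) : ⇑(ofRestrict hs g) =ᵐ[μ] s.indicator g :=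
  MemLp.coeFn_toLp _

/-- Two functions `μ|_s`-a.e. equal have `μ`-a.e. equal indicators on `s`. -/
theorem indicator_ae_eq_of_ae_restrict (hs : MeasurableSet s) {f g : X → E}
    (h : f =ᵐ[μ.restrict s] g) :
    s.indicator f =ᵐ[μ] s.indicator g := by
  filter_upwards [(ae_restrict_iff' hs).mp h] with x hx
  by_cases hxs : x ∈ s
  · rw [Set.indicator_of_mem hxs, Set.indicator_of_mem hxs, hx hxs]
  · rw [Set.indicator_of_notMem hxs, Set.indicator_of_notMem hxs]

/-- On `s`, the indicator `s.indicator g` is `g`: `μ|_s`-a.e. -/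
theorem indicator_ae_eq_restrict (hs : MeasurableSet s) (g : X → E) : s.indicator g =ᵐ[μ.restrict s] g :=
  (ae_restrict_iff' hs).mpr (Filter.Eventually.of_forall fun _ hx => Set.indicator_of_mem hx g)

/-- Extension by zero lands in `V hs`. -/
theorem ofRestrict_mem_V (hs : MeasurableSet s) (g : Lp E 2 (μ.restrict s)) : ofRestrict hs g ∈ V (𝕜 := 𝕜) hs := by
  rw [mem_V_iff_ae]
  filter_upwards [coeFn_ofRestrict hs g] with x hx hxs
  rw [hx, Set.indicator_of_notMem hxs]

/-- Restricting an extension by zero gives the function back. -/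
theorem toRestrict_ofRestrict (hs : MeasurableSet s) (g : Lp E 2 (μ.restrict s)) :
    toRestrict s (ofRestrict hs g) = g := by
  apply Lp.ext
  filter_upwards [coeFn_toRestrict s (ofRestrict hs g), ae_restrict_of_ae (coeFn_ofRestrict hs g),
    indicator_ae_eq_restrict hs (⇑g)] with x h1 h2 h3
  rw [h1, h2, h3]

/-- Extending the restriction of `f ∈ V hs` by zero gives `f` back. -/
theorem ofRestrict_toRestrict (hs : MeasurableSet s) {f : Lp E 2 μ} (hf : f ∈ V (𝕜 := 𝕜) hs) :
    ofRestrict hs (toRestrict s f) = f := by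
  rw [mem_V_iff_ae] at hf
  apply Lp.ext
  filter_upwards [coeFn_ofRestrict hs (toRestrict s f),
    indicator_ae_eq_of_ae_restrict hs (coeFn_toRestrict s f), hf] with x h1 h2 h3
  rw [h1, h2]
  by_cases hxs : x ∈ s
  · rw [Set.indicator_of_mem hxs]
  · rw [Set.indicator_of_notMem hxs, h3 hxs]

/-- `toRestrict` is additive. -/
theorem toRestrict_add (s : Set X) (f g : Lp E 2 μ) :
    toRestrict s (f + g) = toRestrict s f + toRestrict s g := by
  apply Lp.ext
  filter_upwards [coeFn_toRestrict s (f + g), coeFn_toRestrict s f, coeFn_toRestrict s g,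
    Lp.coeFn_add (toRestrict s f) (toRestrict s g), ae_restrict_of_ae (Lp.coeFn_add f g)]
    with x h1 h2 h3 h4 h5
  rw [h4, Pi.add_apply, h2, h3, h1, h5, Pi.add_apply]

/-- `toRestrict` is homogeneous. -/
theorem toRestrict_smul (s : Set X) (c : 𝕜) (f : Lp E 2 μ) :
    toRestrict s (c • f) = c • toRestrict s f := by
  apply Lp.ext
  filter_upwards [coeFn_toRestrict s (c • f), coeFn_toRestrict s f,
    Lp.coeFn_smul c (toRestrict s f), ae_restrict_of_ae (Lp.coeFn_smul c f)] with x h1 h2 h3 h4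
  rw [h3, Pi.smul_apply, h2, h1, h4, Pi.smul_apply]

/-- `‖toRestrict s f‖ = ‖1_s f‖`. -/
theorem norm_toRestrict (hs : MeasurableSet s) (f : Lp E 2 μ) :
    ‖toRestrict s f‖ = ‖restrictL (𝕜 := 𝕜) hs f‖ := by
  rw [norm_restrictL, toRestrict, Lp.norm_toLp]

/-- On `V hs`, `toRestrict` is isometric. -/
theorem norm_toRestrict_of_mem (hs : MeasurableSet s) {f : Lp E 2 μ}
    (hf : f ∈ V (𝕜 := 𝕜) hs) : ‖toRestrict s f‖ = ‖f‖ := by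
  rw [norm_toRestrict (𝕜 := 𝕜) hs, (mem_V_iff hs f).mp hf]

/-- THE IDENTIFICATION OF THE SUMMAND: `V hs ≃ₗᵢ[𝕜] L²(μ|_s)` — restriction of the measure, with
inverse the extension by zero. -/
noncomputable def restrictEquiv (hs : MeasurableSet s) :
    V (𝕜 := 𝕜) (E := E) (μ := μ) hs ≃ₗᵢ[𝕜] Lp E 2 (μ.restrict s) where
  toFun f := toRestrict s (f : Lp E 2 μ)
  invFun g := ⟨ofRestrict hs g, ofRestrict_mem_V hs g⟩
  left_inv f := Subtype.ext (ofRestrict_toRestrict hs f.2)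
  right_inv g := toRestrict_ofRestrict hs g
  map_add' f g := toRestrict_add s (f : Lp E 2 μ) g
  map_smul' c f := toRestrict_smul s c (f : Lp E 2 μ)
  norm_map' f := norm_toRestrict_of_mem hs f.2

/-- `restrictEquiv hs f = toRestrict s f`. -/
@[simp]
theorem restrictEquiv_apply (hs : MeasurableSet s) (f : V (𝕜 := 𝕜) (E := E) (μ := μ) hs) :
    restrictEquiv hs f = toRestrict s (f : Lp E 2 μ) := rfl

/-- `(restrictEquiv hs).symm g = ofRestrict hs g`. -/
@[simp]
theorem restrictEquiv_symm_apply (hs : MeasurableSet s) (g : Lp E 2 (μ.restrict s)) :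
    ((restrictEquiv (𝕜 := 𝕜) (E := E) (μ := μ) hs).symm g : Lp E 2 μ) = ofRestrict hs g := rfl

/-- A measure-preserving `φ` with `φ⁻¹(s) = s` preserves the restricted measure `μ|_s`. -/
theorem measurePreserving_restrict {φ : X → X} (hφ : MeasurePreserving φ μ μ)
    (hs : MeasurableSet s) (hφs : φ ⁻¹' s = s) :
    MeasurePreserving φ (μ.restrict s) (μ.restrict s) := by
  have h := hφ.restrict_preimage hs
  rwa [hφs] at h

/-- Equivariance of the identification: for a measure-preserving `φ` with `φ⁻¹(s) = s`,
restricting commutes with the composition operators on `L²(μ)` and on `L²(μ|_s)`. -/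
theorem toRestrict_compMeasurePreserving (hs : MeasurableSet s) {φ : X → X}
    (hφ : MeasurePreserving φ μ μ) (hφs : φ ⁻¹' s = s) (f : Lp E 2 μ) :
    toRestrict s (Lp.compMeasurePreserving φ hφ f) =
      Lp.compMeasurePreserving φ (measurePreserving_restrict hφ hs hφs) (toRestrict s f) := by
  have hφ' := measurePreserving_restrict hφ hs hφs
  apply Lp.ext
  filter_upwards [coeFn_toRestrict s (Lp.compMeasurePreserving φ hφ f),
    ae_restrict_of_ae (Lp.coeFn_compMeasurePreserving f hφ),
    Lp.coeFn_compMeasurePreserving (toRestrict s f) hφ',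
    hφ'.quasiMeasurePreserving.ae_eq_comp (coeFn_toRestrict s f)] with x h1 h2 h3 h4
  rw [h1, h2, h3, h4]

end Summand

end Summit.Ventures.HodgeRepro2.T5L2Partition
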